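import Mathlib.NumberTheory.Height.EllipticCurve
import Mathlib.NumberTheory.Height.NumberField
import Mathlib.NumberTheory.Height.Northcott
import Mathlib.AlgebraicGeometry.EllipticCurve.Affine.Point
import Mathlib.Topology.Order.Basic
import Mathlib.GroupTheory.OrderOfElement
import HarnessLib

-- provenance: harness21/H21/H21/Prelude/TranscendEllArithS/Heights.lean @ 93a4f70
-- (interim HEAD d8f2665); M5 mechanical rewrite
/-!
# Naive and Néron–Tate heights on `E(K)`

Trunk `TranscendEllArithS` (G06), concept C13 (notions `naive_height_elliptic`,
`neron_tate_height`, `canonical_height_E`).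

For a Weierstrass curve `W` over a field `K` carrying a family of admissible absolute values
(`Height.AdmissibleAbsValues K`, Mathlib) we define, on the Mordell–Weil group
`E(K) = W.toAffine.Point`:

* `WeierstrassCurve.Affine.Point.naiveHeight P = h(x(P))`, the (logarithmic, relative to `K`)
  naive height, `h = Height.logHeight₁` (Mathlib), with `h(O) = 0`;
* `WeierstrassCurve.Affine.Point.canonicalHeight P = lim_{n → ∞} h(2ⁿ P) / 4ⁿ`, Tate's limit
  construction of the Néron–Tate canonical height `ĥ`;
* `WeierstrassCurve.Affine.Point.heightPairing P Q = (ĥ(P + Q) - ĥ P - ĥ Q) / 2`, the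
  Néron–Tate height pairing.

and state the standard theorems over a number field `K` (Silverman, *The Arithmetic of Elliptic
Curves* (AEC), VIII.4–VIII.9): `h(2P) = 4 h(P) + O(1)`, existence of Tate's limit,
`ĥ = h + O(1)`, `ĥ ≥ 0`, `ĥ(nP) = n² ĥ(P)`, the parallelogram law, bilinearity of the pairing,
`ĥ P = 0 ↔ P` torsion, and Northcott finiteness.

## Design choices

* **Namespace.** All declarations live in `WeierstrassCurve.Affine.Point` as a deliberate
  dot-notation extension of Mathlib (so that `P.naiveHeight`, `P.canonicalHeight` work).
* **Mathlib search.** Mathlib has `Height.logHeight₁`, `Height.AdmissibleAbsValues`,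
  `NumberField.instAdmissibleAbsValues`, the `Northcott (logHeight₁)` instance for number fields
  (`Mathlib/NumberTheory/Height/NumberField.lean`) and the projective ingredient
  `WeierstrassCurve.abs_logHeight_addSubMap_sub_two_mul_logHeight_le` towards the approximate
  parallelogram law (`Mathlib/NumberTheory/Height/EllipticCurve.lean`, whose TODO list still
  contains "Define the naïve height"). It has no naive height on points, no canonical height and
  no height pairing (grep `naiveHeight`, `canonicalHeight`, `NeronTate`: nothing). The abstract
  group-level interface `Literature.NumberTheory.DiophantineGeometry.canonicalHeightOf` of trunk `DiophValNum` uses the *same formula* as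
  `canonicalHeight` below; this file is self-contained and elliptic-curve specific.
* **Normalisation.** `h` is the height relative to `K` in Mathlib's normalisation (not divided by
  `[K : ℚ]`). `ĥ` is `lim h(2ⁿP)/4ⁿ` **without** the factor `½` of Silverman AEC VIII.9; this is
  the Clay/Wiles normalisation (A. Wiles, *The Birch and Swinnerton-Dyer conjecture*, Clay problem
  description) and the pairing is `⟨P, Q⟩ = (ĥ(P+Q) - ĥ P - ĥ Q)/2`, so that `⟨P, P⟩ = ĥ P` and
  the regulator agrees with Silverman/LMFDB.
* **Sections.** `section Defs` works over any `[Height.AdmissibleAbsValues K]` and contains the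
  definitions and purely algebraic lemmas only. `section NumberField` assumes `[NumberField K]`
  and uses Mathlib's instance `NumberField.instAdmissibleAbsValues`; every analytic/arithmetic
  theorem is stated there (a theorem stated for a generic admissible family next to
  `[NumberField K]` would refer to an unrelated absolute-value structure).
* **Classical.** `noncomputable section`, `open scoped Classical`, no `[DecidableEq K]` variable,
  uniformly across the trunk, so that Mathlib's `AddCommGroup W.toAffine.Point` instance is always
  elaborated against the classical decidability instance.
* `canonicalHeight` is a `Filter.limUnder`, hence a junk value where the limit does not exist; over
  a number field it always exists (`tendsto_canonicalHeight`).

## References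

* J. H. Silverman, *The Arithmetic of Elliptic Curves*, GTM 106, VIII.4 (heights on projective
  space), VIII.6 (heights on elliptic curves), VIII.9 (canonical height), Theorem VIII.9.3.
* J. Tate, letter to Serre (1962); S. Lang, *Fundamentals of Diophantine Geometry*, Ch. 5.
* D. G. Northcott, *An inequality in the theory of arithmetic on algebraic varieties* (1949).
* A. Wiles, *The Birch and Swinnerton-Dyer conjecture*, Clay Mathematics Institute (2000).
-/

noncomputable section

open scoped Classical

open Filter Topology

namespace WeierstrassCurve.Affine.Point

section Defs

variable {K : Type*} [Field K] [Height.AdmissibleAbsValues K] {W : WeierstrassCurve K}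

/-- The (logarithmic) *naive height* on `E(K)`: `h(P) = h(x(P))` is the logarithmic height
`Height.logHeight₁` of the `x`-coordinate of an affine point, and `h(O) = 0` for the point at
infinity. Silverman, AEC VIII.6 (definition preceding Lemma VIII.6.1), with Mathlib's
normalisation of `logHeight₁` (relative to `K`). [folklore] -/
def naiveHeight : W.toAffine.Point → ℝ
  | 0 => 0
  | some x _ _ => Height.logHeight₁ x

/-- The *Néron–Tate canonical height* on `E(K)`, via Tate's limit
`ĥ(P) = lim_{n → ∞} h(2ⁿ P) / 4ⁿ` (`Filter.limUnder`; junk value if the limit does not exist, which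
does not happen over a number field, see `tendsto_canonicalHeight`). Normalisation **without** the
factor `½` of Silverman AEC VIII.9 (Clay/Wiles normalisation; A. Wiles, Clay problem description).
Silverman, AEC Proposition VIII.9.1; Tate (1962). [cite: Tate1962] -/
def canonicalHeight (P : W.toAffine.Point) : ℝ :=
  limUnder atTop (fun n : ℕ => naiveHeight ((2 ^ n) • P) / 4 ^ n)

/-- The *Néron–Tate height pairing* on `E(K)`: `⟨P, Q⟩ = (ĥ(P + Q) - ĥ P - ĥ Q) / 2`, normalised so
that `⟨P, P⟩ = ĥ P` (`heightPairing_self`, using `ĥ(2P) = 4 ĥ P`).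
Silverman, AEC Theorem VIII.9.3 (pairing), Clay/Wiles normalisation. [folklore] -/
def heightPairing (P Q : W.toAffine.Point) : ℝ :=
  (canonicalHeight (P + Q) - canonicalHeight P - canonicalHeight Q) / 2

/-- The naive height of the point at infinity is `0` (by definition). Silverman, AEC VIII.6.
[folklore] -/
@[simp]
theorem naiveHeight_zero : naiveHeight (0 : W.toAffine.Point) = 0 := rfl

/-- The naive height of an affine point is the height of its `x`-coordinate (by definition).
Silverman, AEC VIII.6. [folklore] -/
@[simp]
theorem naiveHeight_some {x y : K} (h : W.toAffine.Nonsingular x y) :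
    naiveHeight (some x y h) = Height.logHeight₁ x := rfl

/-- The naive height is even, `h(-P) = h(P)`, since `x(-P) = x(P)`. Silverman, AEC VIII.6.
[folklore] -/
@[simp]
theorem naiveHeight_neg (P : W.toAffine.Point) : naiveHeight (-P) = naiveHeight P := by
  cases P <;> rfl

/-- The naive height is nonnegative. Silverman, AEC VIII.6 (and VIII.5.4 for `h ≥ 0`). [folklore] -/
theorem naiveHeight_nonneg (P : W.toAffine.Point) : 0 ≤ naiveHeight P := by
  cases P with
  | zero => exact le_rfl
  | some x y h => exact Height.zero_le_logHeight₁ x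

/-- The canonical height of the point at infinity vanishes (the defining sequence is constantly
`0`; valid over any admissible family). Silverman, AEC Theorem VIII.9.3. [folklore] -/
@[simp]
theorem canonicalHeight_zero : canonicalHeight (0 : W.toAffine.Point) = 0 := by
  have : (fun n : ℕ => naiveHeight ((2 ^ n) • (0 : W.toAffine.Point)) / 4 ^ n) = fun _ => 0 := by
    funext n
    simp
  rw [canonicalHeight, this]
  exact tendsto_const_nhds.limUnder_eq

/-- The canonical height is even: `ĥ(-P) = ĥ(P)`, since already `h(-P) = h(P)` (valid over any
admissible family). Silverman, AEC Theorem VIII.9.3(b). [folklore] -/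
@[simp]
theorem canonicalHeight_neg (P : W.toAffine.Point) :
    canonicalHeight (-P) = canonicalHeight P := by
  have h : (fun n : ℕ => naiveHeight ((2 ^ n) • (-P)) / 4 ^ n) =
      fun n : ℕ => naiveHeight ((2 ^ n) • P) / 4 ^ n := by
    funext n
    rw [smul_neg, naiveHeight_neg]
  simp only [canonicalHeight, h]

/-- The height pairing is symmetric (immediate from commutativity of `E(K)`).
Silverman, AEC Theorem VIII.9.3(d). [folklore] -/
theorem heightPairing_symm (P Q : W.toAffine.Point) : heightPairing P Q = heightPairing Q P := by
  simp only [heightPairing, add_comm P Q]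
  ring

/-- `⟨P, P⟩ = (ĥ(2P) - 2 ĥ P) / 2`, the purely algebraic form of `heightPairing_self`
(valid over any admissible family). Silverman, AEC Theorem VIII.9.3. [folklore] -/
theorem heightPairing_self_eq (P : W.toAffine.Point) :
    heightPairing P P = (canonicalHeight (2 • P) - 2 * canonicalHeight P) / 2 := by
  simp only [heightPairing, two_nsmul]
  ring

end Defs

section NumberField

/- Each named fact below quantifies `[W.IsElliptic]` explicitly in its body: a `Prop`-valued
`def` whose body does not use a section instance silently drops it, and the statements are false
for singular cubics (for `y² = x³`, `E_ns(K) ≅ K⁺` and `h(x(2P)) ≈ 2·h(x(P))`, not `4·`). -/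
variable {K : Type*} [Field K] [NumberField K] {W : WeierstrassCurve K}

/-- Duplication changes the naive height by a factor `4` up to a bounded error:
there is a constant `C = C(W)` with `|h(2P) - 4 h(P)| ≤ C` for all `P ∈ E(K)`.
Silverman, AEC Lemma VIII.6.4 / Theorem VIII.6.2 with `Q = P` (approximate parallelogram law);
cf. Mathlib's `WeierstrassCurve.abs_logHeight_addSubMap_sub_two_mul_logHeight_le`.
[cite: SilvermanAEC2009, Lemma VIII.6.4 and Thm. VIII.6.2] -/
def exists_abs_naiveHeight_two_nsmul_sub_le : Prop :=
  ∀ [W.IsElliptic], ∃ C : ℝ, ∀ P : W.toAffine.Point, |naiveHeight (2 • P) - 4 * naiveHeight P| ≤ C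

/-- The approximate parallelogram law for the naive height:
`|h(P + Q) + h(P - Q) - 2 h(P) - 2 h(Q)| ≤ C` for a constant `C = C(W)`.
Silverman, AEC Theorem VIII.6.2. [cite: SilvermanAEC2009, Thm. VIII.6.2] -/
def exists_abs_naiveHeight_add_add_naiveHeight_sub_sub_le : Prop :=
  ∀ [W.IsElliptic], ∃ C : ℝ, ∀ P Q : W.toAffine.Point,
      |naiveHeight (P + Q) + naiveHeight (P - Q) - 2 * naiveHeight P - 2 * naiveHeight Q| ≤ C

/-- Tate's limit exists: `h(2ⁿ P) / 4ⁿ → ĥ(P)` as `n → ∞`.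
Silverman, AEC Proposition VIII.9.1; Tate (1962). [cite: Tate1962] -/
def tendsto_canonicalHeight : Prop :=
  ∀ [W.IsElliptic] (P : W.toAffine.Point),
    Tendsto (fun n : ℕ => naiveHeight ((2 ^ n) • P) / 4 ^ n) atTop (𝓝 (canonicalHeight P))

/-- The canonical height differs from the naive height by a bounded amount:
`|ĥ(P) - h(P)| ≤ C` for a constant `C = C(W)` (in the normalisation without `½`).
Silverman, AEC Theorem VIII.9.3(e) / Proposition VIII.9.1.
[cite: SilvermanAEC2009, Prop. VIII.9.1 and Thm. VIII.9.3(e)] -/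
def exists_abs_canonicalHeight_sub_naiveHeight_le : Prop :=
  ∀ [W.IsElliptic], ∃ C : ℝ, ∀ P : W.toAffine.Point, |canonicalHeight P - naiveHeight P| ≤ C

/-- The canonical height is nonnegative. Silverman, AEC Theorem VIII.9.3(e) with VIII.5.4.
[cite: SilvermanAEC2009, Thm. VIII.9.3(e) with VIII.5.4] -/
def canonicalHeight_nonneg : Prop :=
  ∀ [W.IsElliptic] (P : W.toAffine.Point),
    0 ≤ canonicalHeight P

/-- The canonical height is a quadratic function: `ĥ(n P) = n² ĥ(P)`.
Silverman, AEC Theorem VIII.9.3(b). [cite: SilvermanAEC2009, Thm. VIII.9.3(b)] -/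
def canonicalHeight_nsmul : Prop :=
  ∀ [W.IsElliptic] (n : ℕ) (P : W.toAffine.Point),
    canonicalHeight (n • P) = (n : ℝ) ^ 2 * canonicalHeight P

/-- The canonical height is a quadratic function: `ĥ(n P) = n² ĥ(P)` for `n : ℤ`.
Silverman, AEC Theorem VIII.9.3(b). [cite: SilvermanAEC2009, Thm. VIII.9.3(b)] -/
def canonicalHeight_zsmul : Prop :=
  ∀ [W.IsElliptic] (n : ℤ) (P : W.toAffine.Point),
    canonicalHeight (n • P) = (n : ℝ) ^ 2 * canonicalHeight P

/-- The parallelogram law for the canonical height: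
`ĥ(P + Q) + ĥ(P - Q) = 2 ĥ(P) + 2 ĥ(Q)`. Silverman, AEC Theorem VIII.9.3(a).
[cite: SilvermanAEC2009, Thm. VIII.9.3(a)] -/
def parallelogram_law : Prop :=
  ∀ [W.IsElliptic] (P Q : W.toAffine.Point),
    canonicalHeight (P + Q) + canonicalHeight (P - Q) =
      2 * canonicalHeight P + 2 * canonicalHeight Q

/-- The height pairing is additive in the first variable (hence bilinear, by symmetry).
Silverman, AEC Theorem VIII.9.3(c). [cite: SilvermanAEC2009, Thm. VIII.9.3(c)] -/
def heightPairing_add_left : Prop :=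
  ∀ [W.IsElliptic] (P Q R : W.toAffine.Point),
    heightPairing (P + Q) R = heightPairing P R + heightPairing Q R

/-- `⟨P, P⟩ = ĥ(P)` in the Clay/Wiles normalisation (from `ĥ(2P) = 4 ĥ(P)`).
Silverman, AEC Theorem VIII.9.3. [folklore] -/
def heightPairing_self : Prop :=
  ∀ [W.IsElliptic] (P : W.toAffine.Point),
    heightPairing P P = canonicalHeight P

/-- `⟨P, P⟩ = ĥ(P)` follows from quadraticity `ĥ(2P) = 4 ĥ(P)` (named fact `canonicalHeight_nsmul`,
hypothesis `h`). [folklore] -/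
theorem heightPairing_self_of (h : canonicalHeight_nsmul (W := W)) : heightPairing_self (W := W) :=
  fun P ↦ by rw [heightPairing_self_eq, h]; ring

/-- The canonical height vanishes exactly on the torsion points: `ĥ(P) = 0 ↔ P ∈ E(K)_tors`.
Silverman, AEC Theorem VIII.9.3(d). [cite: SilvermanAEC2009, Thm. VIII.9.3(d)] -/
def canonicalHeight_eq_zero_iff : Prop :=
  ∀ [W.IsElliptic] (P : W.toAffine.Point),
    canonicalHeight P = 0 ↔ IsOfFinAddOrder P

/-- Torsion points have canonical height `0`. Silverman, AEC Theorem VIII.9.3(d). [folklore] -/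
def canonicalHeight_of_isOfFinAddOrder : Prop :=
  ∀ [W.IsElliptic] {P : W.toAffine.Point}, IsOfFinAddOrder P → canonicalHeight P = 0

/-- Torsion points have height `0`, from the named fact `canonicalHeight_eq_zero_iff` (hypothesis
`h`). [folklore] -/
theorem canonicalHeight_of_isOfFinAddOrder_of (h : canonicalHeight_eq_zero_iff (W := W)) :
    canonicalHeight_of_isOfFinAddOrder (W := W) :=
  fun hP ↦ (h _).mpr hP

/-- **Northcott finiteness** on `E(K)`: for every bound `B` there are only finitely many
`P ∈ E(K)` with naive height `h(P) ≤ B` (each `x` of bounded height has at most two `y`, and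
`{x ∈ K | h(x) ≤ B}` is finite by Mathlib's `Northcott (logHeight₁)` instance for number fields).
Northcott (1949); Silverman, AEC Theorem VIII.5.11 and Proposition VIII.6.1(remark).
[cite: Northcott1949] -/
def finite_setOf_naiveHeight_le : Prop :=
  ∀ [W.IsElliptic] (B : ℝ),
    {P : W.toAffine.Point | naiveHeight P ≤ B}.Finite

/-- Northcott finiteness for the canonical height: `{P ∈ E(K) | ĥ(P) ≤ B}` is finite.
Silverman, AEC Theorem VIII.9.3(e) with VIII.5.11. [folklore] -/
def finite_setOf_canonicalHeight_le : Prop :=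
  ∀ [W.IsElliptic] (B : ℝ),
    {P : W.toAffine.Point | canonicalHeight P ≤ B}.Finite

/-- Northcott for `ĥ` from Northcott for `h` and `|ĥ - h| ≤ C` (named facts
`finite_setOf_naiveHeight_le`, `exists_abs_canonicalHeight_sub_naiveHeight_le`). [folklore] -/
theorem finite_setOf_canonicalHeight_le_of
    (h₁ : exists_abs_canonicalHeight_sub_naiveHeight_le (W := W))
    (h₂ : finite_setOf_naiveHeight_le (W := W)) : finite_setOf_canonicalHeight_le (W := W) := by
  intro _ B
  obtain ⟨C, hC⟩ := h₁
  refine (h₂ (B + C)).subset fun P hP => ?_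
  have h := (abs_sub_le_iff.mp (hC P)).2
  simp only [Set.mem_setOf_eq] at hP ⊢
  linarith

end NumberField

end WeierstrassCurve.Affine.Point
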